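import Mathlib.Analysis.Calculus.ContDiff.Comp
import Mathlib.Analysis.Calculus.ContDiff.Operations
import Mathlib.Analysis.Calculus.TangentCone.Prod
import Mathlib.Analysis.Calculus.FDeriv.Mul
import HarnessLib

/-!
# Partial derivatives of functions smooth on a product `V × S`: slices versus the derivative
# within the product

For a function `F : E × ℝ → G` that is `C^∞` on a product `V ×ˢ S` with `V` open (space) and `S`
a set of times with unique derivatives (an interval), the spatial partial derivatives of the
time-slices `z ↦ F (z, t)` — ordinary Fréchet derivatives on the open set `V` — are the values of
the Fréchet derivative of `F` WITHIN `V ×ˢ S` on horizontal vectors `(v, 0)`; consequently they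
are again `C^∞` on `V ×ˢ S` jointly in `(z, t)`, and so are the iterated spatial derivatives.
This is the calculus behind "all space-time derivatives of a smooth family are smooth"
(Topping 2006, §1.2.3: "`g(t)` is a smooth family of smooth metrics … smooth all the way to
`t = 0` and `t = T`"), in the form needed to read the Laplace–Beltrami operator of a smooth
family of metrics applied to a smooth family of functions in a chart (`ChartLaplacian.lean`,
whose formulas involve the slice derivatives `fderiv ℝ (Gh t)`, `fderiv ℝ (fderiv ℝ (fh t))`).

* `fderiv_slice_eq_fderivWithin_prod` — `D(F(·, t))(y) v = D_{V×S} F (y, t) (v, 0)`;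
* `contDiffOn_fderivWithin_prod_apply` — `q ↦ D_{V×S} F q w` is `C^∞` on `V ×ˢ S`;
* `contDiffOn_fderiv_slice_apply` — `(y, t) ↦ D(F(·, t))(y) v` is `C^∞` on `V ×ˢ S`;
* `contDiffOn_fderiv_fderiv_slice_apply` — `(y, t) ↦ D²(F(·, t))(y)(v, w)` is `C^∞` on `V ×ˢ S`;
* `contDiffOn_slice` — each slice `F(·, t)`, `t ∈ S`, is `C^∞` on `V`.

Everything is proved; no definitions, no named facts.

## References

* P. Topping, *Lectures on the Ricci flow*, LMS Lecture Note Series 325, CUP 2006, §1.2.3.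
  [Topping2006]
-/

noncomputable section

open Set Function
open scoped Topology ContDiff

namespace Literature.Geometry.Riemannian

variable {E : Type*} [NormedAddCommGroup E] [NormedSpace ℝ E]
  {G : Type*} [NormedAddCommGroup G] [NormedSpace ℝ G]
  {F : E × ℝ → G} {V : Set E} {S : Set ℝ}

/-- A slice `z ↦ F (z, t)`, `t ∈ S`, of a function `C^n` on `V ×ˢ S` is `C^n` on `V`. [folklore] -/
theorem contDiffOn_slice {n : ℕ∞ω} (hF : ContDiffOn ℝ n F (V ×ˢ S)) {t : ℝ} (ht : t ∈ S) :
    ContDiffOn ℝ n (fun z ↦ F (z, t)) V :=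
  hF.comp (contDiffOn_id.prodMk contDiffOn_const) (fun _ hz ↦ ⟨hz, ht⟩)

/-- **Slice derivative = derivative within the product on horizontal vectors**: for `F`
differentiable within `V ×ˢ S` at `(y, t)`, `V` open, `y ∈ V`, `t ∈ S`, and the slice
`z ↦ F (z, t)` differentiable at `y`: `D(F(·, t))(y) v = D_{V×S} F (y, t) (v, 0)` (chain rule
along `z ↦ (z, t)`, which maps `V` into `V ×ˢ S`). [folklore] -/
theorem fderiv_slice_eq_fderivWithin_prod (hV : IsOpen V) {y : E} (hy : y ∈ V) {t : ℝ} (ht : t ∈ S)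
    (hF : DifferentiableWithinAt ℝ F (V ×ˢ S) (y, t)) (v : E) :
    fderiv ℝ (fun z ↦ F (z, t)) y v = fderivWithin ℝ F (V ×ˢ S) (y, t) (v, 0) := by
  have hι : HasFDerivAt (fun z : E ↦ (z, t)) (ContinuousLinearMap.inl ℝ E ℝ) y :=
    (hasFDerivAt_id y).prodMk (hasFDerivAt_const t y)
  have hmaps : MapsTo (fun z : E ↦ (z, t)) V (V ×ˢ S) := fun z hz ↦ ⟨hz, ht⟩
  have hcomp : HasFDerivWithinAt (F ∘ fun z : E ↦ (z, t))
      ((fderivWithin ℝ F (V ×ˢ S) (y, t)).comp (ContinuousLinearMap.inl ℝ E ℝ)) V y :=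
    hF.hasFDerivWithinAt.comp y hι.hasFDerivWithinAt hmaps
  have hat : HasFDerivAt (fun z ↦ F (z, t))
      ((fderivWithin ℝ F (V ×ˢ S) (y, t)).comp (ContinuousLinearMap.inl ℝ E ℝ)) y :=
    hcomp.hasFDerivAt (hV.mem_nhds hy)
  rw [hat.fderiv]
  rfl

/-- The Fréchet derivative within `V ×ˢ S` of a `C^∞` function, applied to a fixed vector, is
`C^∞` on `V ×ˢ S` (`V` open, `S` with unique derivatives). [folklore] -/
theorem contDiffOn_fderivWithin_prod_apply (hV : IsOpen V) (hS : UniqueDiffOn ℝ S)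
    (hF : ContDiffOn ℝ ∞ F (V ×ˢ S)) (w : E × ℝ) :
    ContDiffOn ℝ ∞ (fun q ↦ fderivWithin ℝ F (V ×ˢ S) q w) (V ×ˢ S) := by
  have hT : UniqueDiffOn ℝ (V ×ˢ S) := hV.uniqueDiffOn.prod hS
  have hD : ContDiffOn ℝ ∞ (fun q ↦ fderivWithin ℝ F (V ×ˢ S) q) (V ×ˢ S) :=
    hF.fderivWithin hT (by norm_cast)
  exact hD.clm_apply contDiffOn_const

/-- **The spatial partial derivatives of a function `C^∞` on `V ×ˢ S` are `C^∞` on `V ×ˢ S`**: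
`(y, t) ↦ D(F(·, t))(y) v` is `C^∞` jointly (`V` open, `S` with unique derivatives).
[cite: Topping2006, §1.2.3] -/
theorem contDiffOn_fderiv_slice_apply (hV : IsOpen V) (hS : UniqueDiffOn ℝ S)
    (hF : ContDiffOn ℝ ∞ F (V ×ˢ S)) (v : E) :
    ContDiffOn ℝ ∞ (fun q : E × ℝ ↦ fderiv ℝ (fun z ↦ F (z, q.2)) q.1 v) (V ×ˢ S) := by
  refine (contDiffOn_fderivWithin_prod_apply hV hS hF (v, 0)).congr ?_
  rintro ⟨y, t⟩ ⟨hy, ht⟩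
  exact fderiv_slice_eq_fderivWithin_prod hV hy ht
    ((hF (y, t) ⟨hy, ht⟩).differentiableWithinAt (by simp)) v

/-- The second slice derivative as an iterated first slice derivative:
`D²(F(·,t))(y)(v, w) = D(z ↦ D(F(·,t))(z) w)(y) v` for a slice `C²` near `y`. [folklore] -/
theorem fderiv_fderiv_slice_apply (hV : IsOpen V) {y : E} (hy : y ∈ V) {t : ℝ} (ht : t ∈ S)
    (hF : ContDiffOn ℝ ∞ F (V ×ˢ S)) (v w : E) :
    fderiv ℝ (fderiv ℝ (fun z ↦ F (z, t))) y v w =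
      fderiv ℝ (fun z ↦ fderiv ℝ (fun z' ↦ F (z', t)) z w) y v := by
  have hsl : ContDiffOn ℝ ∞ (fun z ↦ F (z, t)) V := contDiffOn_slice hF ht
  have hsl' : ContDiffOn ℝ ∞ (fderiv ℝ (fun z ↦ F (z, t))) V :=
    hsl.fderiv_of_isOpen hV (by norm_cast)
  have hd : DifferentiableAt ℝ (fderiv ℝ (fun z ↦ F (z, t))) y :=
    (hsl'.differentiableOn (by simp) y hy).differentiableAt (hV.mem_nhds hy)
  have h := fderiv_clm_apply (c := fderiv ℝ (fun z ↦ F (z, t))) (u := fun _ : E ↦ w) hd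
    (differentiableAt_const w)
  rw [h]
  simp

/-- **The second spatial partial derivatives are `C^∞` on `V ×ˢ S`**:
`(y, t) ↦ D²(F(·, t))(y)(v, w)` is `C^∞` jointly. [cite: Topping2006, §1.2.3] -/
theorem contDiffOn_fderiv_fderiv_slice_apply (hV : IsOpen V) (hS : UniqueDiffOn ℝ S)
    (hF : ContDiffOn ℝ ∞ F (V ×ˢ S)) (v w : E) :
    ContDiffOn ℝ ∞ (fun q : E × ℝ ↦ fderiv ℝ (fderiv ℝ (fun z ↦ F (z, q.2))) q.1 v w)
      (V ×ˢ S) := by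
  -- the first partial derivative, as a function on the product
  set F₁ : E × ℝ → G := fun q ↦ fderiv ℝ (fun z ↦ F (z, q.2)) q.1 w with hF₁
  have hF₁s : ContDiffOn ℝ ∞ F₁ (V ×ˢ S) := contDiffOn_fderiv_slice_apply hV hS hF w
  have h2 : ContDiffOn ℝ ∞ (fun q : E × ℝ ↦ fderiv ℝ (fun z ↦ F₁ (z, q.2)) q.1 v) (V ×ˢ S) :=
    contDiffOn_fderiv_slice_apply hV hS hF₁s v
  refine h2.congr ?_
  rintro ⟨y, t⟩ ⟨hy, ht⟩
  exact fderiv_fderiv_slice_apply hV hy ht hF v w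

end Literature.Geometry.Riemannian

end
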